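import Summits.Ventures.Crystal3D.Theorems.StickyWulffConstantCoaxialWallLawEndRowOuterShellSigDefs
import HarnessLib

/-!
# Definitions: ALL Barlow payer windows (the `v_max`-free universe) — so that the typed tails read «not on any Barlow stacking»

HONEST FRAMING. Venture `Summits/Ventures/Crystal3D` (cell `crystal3d-full`), crux `CoaxialWallLaw`
(stmt-Ventures-19481, `route-Ventures-StickyWulffConstant`), REGISTERED line `WallLedgerF` (planner cf-p1).  DEFINITIONS
ONLY; nothing is claimed; F-C1 not moved.  cf-p1 DECISION (xlviii) + 23:05:35Z (lane-F chain of record at the signature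
level): with 19481-p1's outer-shell reduction (`…EndRowOuterShellSig`) and the inner-universe certificate
`EndRowOnSiteFlatA v2 (9/2) barlowInnerUniverse`, EVERY Barlow payer window (any number of vacancies) is on the certified
side; the TAILS of `…EndRowOnSiteDefsA` are therefore to be taken over the `v_max`-free universe below, where
`¬ OnSiteAt barlowWindowUniverseAll X z` literally says «the payer window `X ∩ B̄(z,3)` is not a rigid image of (the sites of
one Barlow stacking in the closed radius-`3` ball minus vacancies)» — the NON-BARLOW tail (19481-p1's U-R skeletons,
foreign balls, disordered windows).

* `barlowWindowUniverseAll := ⋃ n, barlowWindowUniverse n`;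
* `mem_barlowWindowUniverseAll_iff` — membership without the vacancy count: `∃ s` (Hägg) `∃ V ⊆ Λ(s)`,
  `↑P = (Λ(s) ∩ B̄(0,3)) ∖ V`, `0 ∈ P`, `deg 0 ≤ 11`;
* `barlowWindowUniverse_subset_all`, `isBarlowWindow_of_mem_barlowWindowUniverseAll`.
WHAT THIS IS NOT: no tail is proved; F-C1 not moved.
-/

noncomputable section

namespace Summit.Ventures.Crystal3D.Theorems

open Summit.Ventures.Crystal3D Finset
open Literature.MathematicalPhysics.StatisticalMechanics (barlowStacking IsHaggSeq)

/-- **ALL BARLOW PAYER WINDOWS**: the union over `vmax` of the universes U-W(`vmax`). -/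
def barlowWindowUniverseAll : Set (Finset (EuclideanSpace ℝ (Fin 3))) :=
  ⋃ n : ℕ, barlowWindowUniverse n

/-- U-W(`vmax`) is part of the `vmax`-free universe. -/
theorem barlowWindowUniverse_subset_all (vmax : ℕ) : barlowWindowUniverse vmax ⊆ barlowWindowUniverseAll :=
  Set.subset_iUnion barlowWindowUniverse vmax

open scoped Classical in
/-- Membership in the `vmax`-free universe: a Barlow payer window with ANY finite vacancy set. -/
theorem mem_barlowWindowUniverseAll_iff {P : Finset (EuclideanSpace ℝ (Fin 3))} :
    P ∈ barlowWindowUniverseAll ↔ ∃ s : ℤ → ℤ, IsHaggSeq s ∧ ∃ V : Finset (EuclideanSpace ℝ (Fin 3)),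
      (↑V : Set (EuclideanSpace ℝ (Fin 3))) ⊆ barlowStacking 1 (Real.sqrt (2 / 3)) s ∧
      (↑P : Set (EuclideanSpace ℝ (Fin 3))) =
        (barlowStacking 1 (Real.sqrt (2 / 3)) s ∩ Metric.closedBall 0 3) \ ↑V ∧
      (0 : EuclideanSpace ℝ (Fin 3)) ∈ P ∧ (P.filter fun q => dist (0 : EuclideanSpace ℝ (Fin 3)) q = 1).card ≤ 11 := by
  unfold barlowWindowUniverseAll
  rw [Set.mem_iUnion]
  constructor
  · rintro ⟨n, s, hs, V, -, hV, hP, h0, hdeg⟩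
    exact ⟨s, hs, V, hV, hP, h0, hdeg⟩
  · rintro ⟨s, hs, V, hV, hP, h0, hdeg⟩
    exact ⟨V.card, s, hs, V, le_rfl, hV, hP, h0, hdeg⟩

/-- Every pattern of the `vmax`-free universe is a Barlow window. -/
theorem isBarlowWindow_of_mem_barlowWindowUniverseAll {P : Finset (EuclideanSpace ℝ (Fin 3))}
    (h : P ∈ barlowWindowUniverseAll) : IsBarlowWindow P := by
  obtain ⟨n, hn⟩ := Set.mem_iUnion.1 h
  exact isBarlowWindow_of_mem_barlowWindowUniverse hn

end Summit.Ventures.Crystal3D.Theorems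

end
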